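import Literature.Topology.FourManifolds.MorseDiscLemma
import Literature.Topology.FourManifolds.RegularIntervalLevels
import HarnessLib

/-!
# The disc theorem for a single critical point, with a prescribed profile near the boundary

Topic `Literature/Topology/FourManifolds` (fact seat
`provefact-Literature.Topology.FourManifolds.IsHandlebody.exists_isBoundaryGluing_sphere`, step F2b of
the Lickorish–Wallace DAG; base case of the classification of handlebodies
`IsHandlebody.nonempty_diffeomorph` with the level-compatibility invariant of its induction).
Everything here is **proved**; no named facts.

`MorseDiscLemma.lean` proves that a compact manifold with boundary carrying an adapted Morse
function `f` with a single critical point `p`, of index `0`, is diffeomorphic to the closed unit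
ball (Milnor, *Morse theory* (1963), Thm. 3.1 with the Lemma of Morse, as in the proof of
Thm. 4.1), by `M ≅ M^{f(p)+r²} ≅ 𝔻ᵏ⁺¹`.  Here the two parameters of that construction — the
radius `r` of the Morse-chart ball and the height `a₀` of the push (`RegularIntervalLevels.lean`)
— are exposed, together with the resulting **norm of the image of a point near `∂M`**:
`‖G x‖² = 1 + (κ(a₀) - σ_{a₀}(1 - f x)) / r²`
(`Literature.Topology.FourManifolds.IsMorseAdapted.exists_diffeomorph_closedBall_norm_sq_eq`).
It depends on `x` only through the depth `1 - f x`, and on `(M, f)` only through `(r, a₀)`: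
two such manifolds treated with common `(r, a₀)` are compared by a diffeomorphism
`G'⁻¹ ∘ G` preserving the depth near the boundary.

## References

* J. Milnor, *Morse theory*, Ann. of Math. Studies 51 (1963), Lemma 2.2, Thm. 3.1 and the proof
  of Thm. 4.1 (p. 25). [Milnor1963]
-/

open scoped Manifold ContDiff Topology
open Set Function Filter Metric

noncomputable section

namespace Literature.Topology.FourManifolds

universe u

/-- Local notation: `𝔼 n` is the model Euclidean space `EuclideanSpace ℝ (Fin n)`. -/
local notation "𝔼 " n:arg => EuclideanSpace ℝ (Fin n)

/-- Local notation: `𝔻 n` is the closed unit ball in `EuclideanSpace ℝ (Fin n)`. -/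
local notation "𝔻 " n:arg => (Metric.closedBall (0 : EuclideanSpace ℝ (Fin n)) 1)

attribute [local instance] fact_finrank_euclideanSpace_succ

variable {k : ℕ} {M : Type u} [TopologicalSpace M] [T2Space M] [CompactSpace M]
  [ChartedSpace (EuclideanHalfSpace (k + 1)) M] [IsManifold (𝓡∂ (k + 1)) ∞ M]

/-- **The disc theorem with a prescribed profile** (Milnor 1963, Thm. 3.1 with Lemma 2.2, as in
the proof of Thm. 4.1).  Let `f` be a Morse function adapted to the boundary of the compact
manifold with boundary `M` (dimension `k + 1 ≥ 2`) with a single critical point `p`, of index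
`0`.  There is `r_max > 0`, and for every radius `r ∈ (0, r_max]` a bound `a_max > 0`, such that
for every height `a₀ ∈ (0, a_max]` there are a diffeomorphism `G : M ≅ 𝔻ᵏ⁺¹` and `s₀ > 0` with
`‖G x‖² = 1 + (κ(a₀) - σ_{a₀}(1 - f x)) / r²` whenever `1 - f x < s₀`
(`κ = pushDepthOf`, `σ = pushShiftOf`; `G` is the composite of `M ≅ M^{f(p)+r²}` of
`RegularIntervalLevels.lean` and the rescaled Morse chart `M^{f(p)+r²} ≅ 𝔻ᵏ⁺¹` of
`MorseDiscLemma.lean`). [cite: Milnor1963, Thm. 3.1, Lemma 2.2 and proof of Thm. 4.1 (p. 25)] -/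
theorem IsMorseAdapted.exists_diffeomorph_closedBall_norm_sq_eq (hk : 1 ≤ k) {f : M → ℝ}
    (hf : IsMorseAdapted (𝓡∂ (k + 1)) f) {p : M} (hp : IsMCriticalPt (𝓡∂ (k + 1)) f p)
    (huniq : ∀ q, IsMCriticalPt (𝓡∂ (k + 1)) f q → q = p)
    (h0 : morseIndex (𝓡∂ (k + 1)) f p = 0) :
    ∃ rmax : ℝ, 0 < rmax ∧ ∀ r : ℝ, 0 < r → r ≤ rmax →
      ∃ amax : ℝ, 0 < amax ∧ ∀ a₀ : ℝ, 0 < a₀ → a₀ ≤ amax →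
        ∃ (G : M ≃ₘ⟮𝓡∂ (k + 1), 𝓡∂ (k + 1)⟯ (𝔻 (k + 1))) (s₀ : ℝ), 0 < s₀ ∧
          ∀ x, 1 - f x < s₀ →
            ‖((G x : 𝔻 (k + 1)) : 𝔼 (k + 1))‖ ^ 2 =
              1 + (pushDepthOf a₀ - pushShiftOf a₀ (1 - f x)) / r ^ 2 := by
  obtain ⟨ψ, y₀, r₀, hψ, hr₀, hc1, hquad, hr'⟩ := hf.exists_chart_sublevel_eq_closedBall hp huniq h0
  refine ⟨r₀, hr₀, fun r hr hrr₀ => ?_⟩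
  obtain ⟨hsub, hball, hiff⟩ := hr' r hr hrr₀
  set c : ℝ := f p + r ^ 2 with hc
  have hrsq : r ^ 2 ≤ r₀ ^ 2 := by nlinarith
  have hc1' : c < 1 := by rw [hc]; linarith
  have hcrit : ∀ x, IsMCriticalPt (𝓡∂ (k + 1)) f x → f x < c := fun x hx => by
    rw [huniq x hx, hc]; nlinarith
  obtain ⟨hint, hreg'⟩ := hf.sublevelAtlas_hyps hc1' hcrit
  letI := (sublevelAtlas hf.1.1 c hint hreg').chartedSpace
  obtain ⟨amax, hamax, hG₁⟩ := exists_diffeomorph_sublevel_apply_eq hk hf.1.1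
    (fun x hx => (hf.2.1 x hx).1) hf.2.2 hc1'
    (fun x hx hcx => absurd (hcrit x hcx) (not_lt.2 hx)) hint hreg'
  refine ⟨amax, hamax, fun a₀ ha₀ ha₀le => ?_⟩
  obtain ⟨G₁, s₀, hs₀, hG₁lev⟩ := hG₁ a₀ ha₀ ha₀le
  obtain ⟨Ψ, hΨ⟩ := exists_diffeomorph_closedBall_of_chart hk hf.1.1 hint hreg' hψ hr hsub hball hiff
  refine ⟨G₁.trans Ψ, s₀, hs₀, fun x hx => ?_⟩
  have hmem : (G₁ x).1 ∈ ψ.source := hsub (G₁ x).2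
  have hq : ‖(𝓡∂ (k + 1)) (ψ (G₁ x).1) - y₀‖ ^ 2 = f (G₁ x).1 - f p := by
    have h := hquad _ hmem; linarith
  rw [Diffeomorph.coe_trans, comp_apply, hΨ, norm_smul, norm_inv, Real.norm_eq_abs, abs_of_pos hr,
    mul_pow, hq, hG₁lev x hx, hc]
  field_simp
  ring

/-! ### Level-compatible comparison of two discs -/

omit [T2Space M] [IsManifold (𝓡∂ (k + 1)) ∞ M] in
/-- **An open set containing the top level contains a whole collar** `{1 - f < s₁}`: if `U` is
open and `f < 1` off `U` (e.g. `U ⊇ ∂M` for `f` adapted to the boundary), then by compactness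
`1 - f` is bounded below off `U`. [folklore] -/
theorem exists_pos_forall_sub_lt_mem {f : M → ℝ} (hfc : Continuous f) {U : Set M} (hU : IsOpen U)
    (h1 : ∀ x, x ∉ U → f x < 1) : ∃ s₁ : ℝ, 0 < s₁ ∧ ∀ x, 1 - f x < s₁ → x ∈ U := by
  have hKc : IsCompact Uᶜ := hU.isClosed_compl.isCompact
  rcases (Uᶜ : Set M).eq_empty_or_nonempty with hKe | hKne
  · refine ⟨1, one_pos, fun x _ => ?_⟩
    by_contra hx
    have : x ∈ (Uᶜ : Set M) := hx
    rw [hKe] at this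
    exact this
  · obtain ⟨x₀, hx₀, hmax⟩ := hKc.exists_isMaxOn hKne hfc.continuousOn
    refine ⟨1 - f x₀, by linarith [h1 x₀ hx₀], fun x hx => ?_⟩
    by_contra hxU
    have h := hmax (show x ∈ Uᶜ from hxU)
    simp only [mem_setOf_eq] at h
    linarith

/-- **Base case of the classification of handlebodies, with the level-compatibility
invariant**: two compact manifolds with boundary of the same dimension `k + 1 ≥ 2`, each with
an adapted Morse function having a single critical point of index `0`, are diffeomorphic by a
diffeomorphism `Ψ` which **preserves the levels near the boundary**, `f' (Ψ x) = f x` whenever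
`1 - f x < s₁`.  Both are pushed onto `𝔻ᵏ⁺¹` with common parameters `(r, a₀)`
(`IsMorseAdapted.exists_diffeomorph_closedBall_norm_sq_eq`), so that `Ψ = G'⁻¹ ∘ G` matches the
depths where both level formulas hold; that `Ψ` maps a thin collar of `∂M` into the collar of
`∂M'` where the formula for `G'` holds follows from the invariance of the boundary under
diffeomorphisms (Mathlib's `Diffeomorph.preimage_boundary`) and compactness.  Milnor 1963,
Thm. 3.1 with Lemma 2.2; Kosinski (1993), VI §7 / VII §2 ("attaching no handles").
[cite: Milnor1963, Thm. 3.1 and proof of Thm. 4.1] [cite: Kosinski1993, VII §2] -/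
theorem IsMorseAdapted.exists_diffeomorph_apply_eq_of_unique_isMCriticalPt (hk : 1 ≤ k)
    {M' : Type u} [TopologicalSpace M'] [T2Space M'] [CompactSpace M']
    [ChartedSpace (EuclideanHalfSpace (k + 1)) M'] [IsManifold (𝓡∂ (k + 1)) ∞ M']
    {f : M → ℝ} (hf : IsMorseAdapted (𝓡∂ (k + 1)) f) {p : M}
    (hp : IsMCriticalPt (𝓡∂ (k + 1)) f p) (huniq : ∀ q, IsMCriticalPt (𝓡∂ (k + 1)) f q → q = p)
    (h0 : morseIndex (𝓡∂ (k + 1)) f p = 0)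
    {f' : M' → ℝ} (hf' : IsMorseAdapted (𝓡∂ (k + 1)) f') {p' : M'}
    (hp' : IsMCriticalPt (𝓡∂ (k + 1)) f' p')
    (huniq' : ∀ q, IsMCriticalPt (𝓡∂ (k + 1)) f' q → q = p')
    (h0' : morseIndex (𝓡∂ (k + 1)) f' p' = 0) :
    ∃ (Ψ : M ≃ₘ⟮𝓡∂ (k + 1), 𝓡∂ (k + 1)⟯ M') (s₁ : ℝ), 0 < s₁ ∧
      ∀ x, 1 - f x < s₁ → f' (Ψ x) = f x := by
  -- common radius and common height
  obtain ⟨rmax, hrmax, hr⟩ := hf.exists_diffeomorph_closedBall_norm_sq_eq hk hp huniq h0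
  obtain ⟨rmax', hrmax', hr'⟩ := hf'.exists_diffeomorph_closedBall_norm_sq_eq hk hp' huniq' h0'
  set r := min rmax rmax' with hrdef
  have hrpos : 0 < r := lt_min hrmax hrmax'
  obtain ⟨amax, hamax, ha⟩ := hr r hrpos (min_le_left _ _)
  obtain ⟨amax', hamax', ha'⟩ := hr' r hrpos (min_le_right _ _)
  set a₀ := min amax amax' with ha₀def
  have ha₀pos : 0 < a₀ := lt_min hamax hamax'
  obtain ⟨G, s₀, hs₀, hG⟩ := ha a₀ ha₀pos (min_le_left _ _)
  obtain ⟨G', s₀', hs₀', hG'⟩ := ha' a₀ ha₀pos (min_le_right _ _)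
  set Ψ := G.trans G'.symm with hΨ
  -- `Ψ` maps a thin collar of `∂M` into `{1 - f' < s₀'}`
  set U' : Set M' := {x' | 1 - f' x' < s₀'} with hU'
  have hU'o : IsOpen U' := isOpen_lt (continuous_const.sub hf'.1.1.continuous) continuous_const
  have hUo : IsOpen (Ψ ⁻¹' U') := hU'o.preimage Ψ.continuous
  have hbd : Ψ ⁻¹' (𝓡∂ (k + 1)).boundary M' = (𝓡∂ (k + 1)).boundary M :=
    Ψ.preimage_boundary (by simp)
  have h1 : ∀ x, x ∉ Ψ ⁻¹' U' → f x < 1 := by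
    intro x hx
    refine hf.2.2 x (((𝓡∂ (k + 1)).isInteriorPoint_or_isBoundaryPoint x).resolve_right fun hb => ?_)
    have hb' : x ∈ Ψ ⁻¹' (𝓡∂ (k + 1)).boundary M' := by rw [hbd]; exact hb
    have h1' : f' (Ψ x) = 1 := (hf'.2.1 _ hb').1
    exact hx (show 1 - f' (Ψ x) < s₀' by rw [h1', sub_self]; exact hs₀')
  obtain ⟨s₂, hs₂, hcollar⟩ := exists_pos_forall_sub_lt_mem hf.1.1.continuous hUo h1
  refine ⟨Ψ, min s₀ s₂, lt_min hs₀ hs₂, fun x hx => ?_⟩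
  have hx₀ : 1 - f x < s₀ := lt_of_lt_of_le hx (min_le_left _ _)
  have hx₂ : 1 - f x < s₂ := lt_of_lt_of_le hx (min_le_right _ _)
  have hxU : Ψ x ∈ U' := hcollar x hx₂
  -- both level formulas, for the same point of `𝔻`
  have hGx : G' (Ψ x) = G x := by
    rw [hΨ, Diffeomorph.coe_trans, comp_apply, Diffeomorph.apply_symm_apply]
  have h := hG' (Ψ x) hxU
  rw [hGx, hG x hx₀] at h
  have hr2 : (0 : ℝ) < r ^ 2 := by positivity
  have hσ : pushShiftOf a₀ (1 - f' (Ψ x)) = pushShiftOf a₀ (1 - f x) := by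
    field_simp at h
    linarith
  have := (strictMono_pushShiftOf ha₀pos).injective hσ
  linarith

end Literature.Topology.FourManifolds
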